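import Summits.CriticalPhenomena.PercolationContinuityZ3.Theorems.PercNearOneGluingNoHeavyLowerTailSahiGridPatternCoCountProductT
import Summits.CriticalPhenomena.PercolationContinuityZ3.Theorems.PercNearOneGluingNoHeavyLowerTailSahiGridPatternDiagRouteTopCube
import Summits.CriticalPhenomena.PercolationContinuityZ3.Theorems.PercNearOneGluingNoHeavyLowerTailSahiGridPatternZeroLocusIndep

/-!
# `NoHeavyLowerTail` (crux stmt-CriticalPhenomena-4575), Sahi programme P1: **CONDITION (N) OF THE CO-COUNT PRODUCT IS MONOTONE IN THE FIRST CERTIFICATE** —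
# it follows from the trivial-tensor case BA₀(S) for EVERY certificate `d_S` of `S`; hence the co-count product certifies `S × V` for every TOP-CUBE `S`,
# every certificate of `S` and every certificate of `V` (every `n, k`)

Support file (Sahi cell, seat `prim-sahi-p1`, generation 34; `--supports stmt-CriticalPhenomena-4575`).  Pure proofs, no definitions, no `sorry`, standard axioms.
Vocabulary of `…SahiGridPattern{,CellForm,DiagCert,DiagCertBlockAndT,CoCountProductT,DiagRouteTopCube,ZeroLocusIndep}`.

THE MATHEMATICS (seat memo FROM-prim-sahi-p1-gen34, §2.5).  For `A = S × V ⊆ [3]^{n+k}` and vectors `d_S`, `d_V` the co-count product vector is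
`d'(x) = 2^{n+k+1}1_S(ξ)1_V(q) − m_S(ξ)m_V(q)` (`x = glue ξ q`, `m_X = 2^{dim+1}1_X − d_X`; file `…CoCountProductT`, where its (T) condition is proved).  Its (N)
condition — CONJECTURE A of the memo — reads `Θ_A(P×Q) ≤ d'(P∩Q)`.  KEY IDENTITY (`coProduct_sub_trivialTensor`):
    `d'(x) − 2^n·1_S(ξ)·d_V(q) = (d_S(ξ) − 2^n·1_S(ξ))·m_V(q)`,
so `d'(P∩Q) − (2^n1_S⊗d_V)(P∩Q) = Σ_q m_V(q)·(d_S − 2^n1_S)((P∩Q)_q)` (fibres).  Now (N) for `S` at the pair `(X, ⊤)` says exactly `(d_S − 2^n1_S)(X) ≥ 0` for every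
up-set `X` (`trivial_le_of_diagCert_N`, via `Θ_S(X×⊤) = 2^n·#(X∩S)`), and `m_V ≥ 0` whenever `d_V ≤ 2^{k+1}1_V`.  Hence:
**THEOREM (`diagCert_coProduct_N_of_trivialTensor`).**  If the trivial tensor `2^n·1_S ⊗ d_V` satisfies (N) for `S × V` (this is BA₀(S), generation 29/31) and `d_S ⪰ 2^n1_S`
on up-sets (e.g. `d_S` satisfies (N) for `S`), `d_V ≤ 2^{k+1}1_V`, then the co-count product of `d_S` and `d_V` satisfies (N) for `S × V` — for EVERY such `d_S`.
**COROLLARY (`diagCert_coProduct_N_topCube`, `sStarD_blockAnd_topCube_nonneg_of_coProduct`).**  For every up-set `S` of a top cube `{1,2}^n`, every `d_S` with (N) for `S`,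
every up-set `V` and every `d_V ≥ 0` with (N) for `V` and `d_V ≤ 2^{k+1}1_V`: the co-count product satisfies (N) (by `diagCert_blockAnd_N_topCube`, generation 31), and with
(T) for `d_S`, `d_V` (`diagCert_coProduct_T`) the block product `S × V` is a good first slot of `[3]^{n+k}`.  So CONJECTURE A holds for all top-cube first blocks; in general it
is equivalent to its own special case at the ⪯-minimal ("most bottom-heavy") certificates of `S`.  Nothing here asserts Conjecture A in general or `PatternPos d` for `d ≥ 4`.
[this work]
-/

namespace Summit.CriticalPhenomena.PercolationContinuityZ3.Theorems.SahiGridPattern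

open Finset SahiGrid3
open scoped BigOperators

variable {n k : ℕ} {S : Finset (Pd n)} {V : Finset (Pd k)} {A : Finset (Pd (n + k))}

/-- **Key identity**: co-count product minus trivial tensor is `(d_S − 2^n1_S) ⊗ m_V`. [this work] -/
theorem coProduct_sub_trivialTensor (dS : Pd n → ℤ) (dV : Pd k → ℤ) (ξ : Pd n) (q : Pd k) :
    (2 * (2:ℤ) ^ (n + k) * (ind S ξ * ind V q) - (2 * (2:ℤ) ^ n * ind S ξ - dS ξ) * (2 * (2:ℤ) ^ k * ind V q - dV q))
      - (2:ℤ) ^ n * ind S ξ * dV q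
      = (dS ξ - (2:ℤ) ^ n * ind S ξ) * (2 * (2:ℤ) ^ k * ind V q - dV q) := by
  rw [pow_add]; ring

/-- **`Θ_S(X × ⊤) = 2^n · #(X ∩ S)`** (as an indicator sum), for arbitrary finsets `S, X ⊆ [3]^n`. [this work] -/
theorem sum_mem_sum_univ_thetaVal_eq (S X : Finset (Pd n)) :
    (∑ q ∈ X, ∑ r ∈ (univ : Finset (Pd n)), thetaVal S q r) = (2:ℤ) ^ n * ∑ q ∈ X, ind S q := by
  have h1 := sStarD_eq_sum_lamU_sub_sum_thetaVal S X univ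
  have h2 := sStarD_univ_eq_harrisSlack S X
  rw [Finset.inter_univ] at h1
  -- `Σ_{q∈X} λ_S(q) = 2·2^n Σ_{q∈X} 1_S(q) − Σ_{q∈X} ν_S(q)` and `Σ_{q∈X} ν_S(q) = Σ_p Σ_q 1_S(p) 1_X(q) [p δ̸ q]`
  have hlam : (∑ q ∈ X, lamU S q) = 2 * (2:ℤ) ^ n * (∑ q ∈ X, ind S q) - ∑ q ∈ X, (nuCount S q : ℤ) := by
    unfold lamU
    rw [Finset.sum_sub_distrib, ← Finset.mul_sum]
  have hnu : (∑ q ∈ X, (nuCount S q : ℤ)) = ∑ p : Pd n, ∑ q : Pd n, ind S p * ind X q * (if TotDist p q = true then (1:ℤ) else 0) := by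
    rw [sum_mem_eq_sum_ind_mul X]
    simp only [nuCount_eq_sum_ind, Finset.mul_sum]
    rw [Finset.sum_comm]
    exact Finset.sum_congr rfl fun p _ => Finset.sum_congr rfl fun q _ => by ring
  have hind : (∑ q ∈ X, ind S q) = ∑ p : Pd n, ind S p * ind X p := by
    rw [sum_mem_eq_sum_ind_mul X]
    refine Finset.sum_congr rfl fun p _ => ?_
    ring
  rw [hind] at hlam ⊢
  linarith

/-- **(N) for `S` forces `d_S ⪰ 2^n·1_S`**: `2^n · Σ_{q∈X} 1_S(q) ≤ Σ_{q∈X} d_S(q)` for every up-set `X` (the pair `(X, ⊤)`). [this work] -/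
theorem trivial_le_of_diagCert_N (dS : Pd n → ℤ)
    (hN : ∀ X X' : Finset (Pd n), IsUpperSet (X : Set (Pd n)) → IsUpperSet (X' : Set (Pd n)) → (∑ q ∈ X, ∑ r ∈ X', thetaVal S q r) ≤ ∑ q ∈ X ∩ X', dS q)
    {X : Finset (Pd n)} (hX : IsUpperSet (X : Set (Pd n))) :
    (2:ℤ) ^ n * (∑ q ∈ X, ind S q) ≤ ∑ q ∈ X, dS q := by
  have h := hN X univ hX (fun _ _ _ _ => Finset.mem_coe.2 (Finset.mem_univ _))
  rw [sum_mem_sum_univ_thetaVal_eq, Finset.inter_univ] at h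
  exact h

/-- **THEOREM ((N) of the co-count product from the trivial-tensor case; every `n, k`).**  Let `A = S × V`.  If `2^n·1_S ⊗ d_V` satisfies (N) for `A`
(hypothesis `hBA0`), `d_S ⪰ 2^n·1_S` on up-sets (`hgS`) and `d_V ≤ 2^{k+1}·1_V` pointwise (`hmV`), then the co-count product of `d_S`, `d_V` satisfies (N) for `A`.
[this work] -/
theorem diagCert_coProduct_N_of_trivialTensor (dS : Pd n → ℤ) (dV : Pd k → ℤ)
    (hBA0 : ∀ P Q : Finset (Pd (n + k)), IsUpperSet (P : Set (Pd (n + k))) → IsUpperSet (Q : Set (Pd (n + k))) →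
      (∑ x ∈ P, ∑ y ∈ Q, thetaVal A x y) ≤ ∑ x ∈ P ∩ Q, (2:ℤ) ^ n * ind S (freeOf x) * dV (cellOf x))
    (hgS : ∀ X : Finset (Pd n), IsUpperSet (X : Set (Pd n)) → (2:ℤ) ^ n * (∑ ξ ∈ X, ind S ξ) ≤ ∑ ξ ∈ X, dS ξ)
    (hmV : ∀ q : Pd k, dV q ≤ 2 * (2:ℤ) ^ k * ind V q)
    {P Q : Finset (Pd (n + k))} (hP : IsUpperSet (P : Set (Pd (n + k)))) (hQ : IsUpperSet (Q : Set (Pd (n + k)))) :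
    (∑ x ∈ P, ∑ y ∈ Q, thetaVal A x y) ≤ ∑ x ∈ P ∩ Q, (2 * (2:ℤ) ^ (n + k) * (ind S (freeOf x) * ind V (cellOf x))
        - (2 * (2:ℤ) ^ n * ind S (freeOf x) - dS (freeOf x)) * (2 * (2:ℤ) ^ k * ind V (cellOf x) - dV (cellOf x))) := by
  have hW : IsUpperSet ((P ∩ Q : Finset (Pd (n + k))) : Set (Pd (n + k))) := isUpperSet_inter_coe hP hQ
  have hdiff : (∑ x ∈ P ∩ Q, (2 * (2:ℤ) ^ (n + k) * (ind S (freeOf x) * ind V (cellOf x))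
        - (2 * (2:ℤ) ^ n * ind S (freeOf x) - dS (freeOf x)) * (2 * (2:ℤ) ^ k * ind V (cellOf x) - dV (cellOf x))))
      - (∑ x ∈ P ∩ Q, (2:ℤ) ^ n * ind S (freeOf x) * dV (cellOf x))
      = ∑ q : Pd k, (2 * (2:ℤ) ^ k * ind V q - dV q) * ∑ ξ ∈ fibre (P ∩ Q) q, (dS ξ - (2:ℤ) ^ n * ind S ξ) := by
    rw [← Finset.sum_sub_distrib, sum_mem_eq_sum_glue, Finset.sum_comm]
    refine Finset.sum_congr rfl fun q _ => ?_
    rw [← sum_ind_glue_mul_eq_sum_fibre, Finset.mul_sum]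
    refine Finset.sum_congr rfl fun ξ _ => ?_
    simp only [freeOf_glue, cellOf_glue]
    rw [coProduct_sub_trivialTensor]
    ring
  have hpos : 0 ≤ ∑ q : Pd k, (2 * (2:ℤ) ^ k * ind V q - dV q) * ∑ ξ ∈ fibre (P ∩ Q) q, (dS ξ - (2:ℤ) ^ n * ind S ξ) := by
    refine Finset.sum_nonneg fun q _ => mul_nonneg (by linarith [hmV q]) ?_
    have h := hgS (fibre (P ∩ Q) q) (isUpperSet_fibre hW q)
    rw [Finset.sum_sub_distrib, ← Finset.mul_sum]
    linarith
  linarith [hBA0 P Q hP hQ]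

/-- **COROLLARY (Conjecture A for every top-cube first block; every `n, k`).**  `S ⊆ {1,2}^n` an up-set, `d_S` with (N) for `S`; `V` an up-set, `d_V ≥ 0` with (N) for `V`
and `d_V ≤ 2^{k+1}1_V`.  Then the co-count product of `d_S`, `d_V` satisfies (N) for `S × V`. [this work] -/
theorem diagCert_coProduct_N_topCube (hS : IsUpperSet (S : Set (Pd n))) (htop : ∀ ξ ∈ S, ∀ a, ξ a ≠ 0)
    (hV : IsUpperSet (V : Set (Pd k))) (hA : ∀ ξ z, glue ξ z ∈ A ↔ (ξ ∈ S ∧ z ∈ V)) (dS : Pd n → ℤ) (dV : Pd k → ℤ)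
    (hNS : ∀ X X' : Finset (Pd n), IsUpperSet (X : Set (Pd n)) → IsUpperSet (X' : Set (Pd n)) → (∑ q ∈ X, ∑ r ∈ X', thetaVal S q r) ≤ ∑ q ∈ X ∩ X', dS q)
    (hdV : ∀ q, 0 ≤ dV q) (hmV : ∀ q : Pd k, dV q ≤ 2 * (2:ℤ) ^ k * ind V q)
    (hNV : ∀ X X' : Finset (Pd k), IsUpperSet (X : Set (Pd k)) → IsUpperSet (X' : Set (Pd k)) → (∑ q ∈ X, ∑ r ∈ X', thetaVal V q r) ≤ ∑ q ∈ X ∩ X', dV q)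
    {P Q : Finset (Pd (n + k))} (hP : IsUpperSet (P : Set (Pd (n + k)))) (hQ : IsUpperSet (Q : Set (Pd (n + k)))) :
    (∑ x ∈ P, ∑ y ∈ Q, thetaVal A x y) ≤ ∑ x ∈ P ∩ Q, (2 * (2:ℤ) ^ (n + k) * (ind S (freeOf x) * ind V (cellOf x))
        - (2 * (2:ℤ) ^ n * ind S (freeOf x) - dS (freeOf x)) * (2 * (2:ℤ) ^ k * ind V (cellOf x) - dV (cellOf x))) :=
  diagCert_coProduct_N_of_trivialTensor dS dV (fun _ _ hP' hQ' => diagCert_blockAnd_N_topCube hS htop hV hA dV hdV hNV hP' hQ')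
    (fun _ hX => trivial_le_of_diagCert_N dS hNS hX) hmV hP hQ

/-- **COROLLARY (the block product `S × V` is GOOD for every top-cube `S`, via the co-count product of ANY two certificates).**  With (T) for `d_S` (and
`d_S ≤ 2^{n+1}1_S`) and (T) for `d_V` in addition: `0 ≤ sStarD (S × V) B C` for all up-sets `B, C ⊆ [3]^{n+k}`. [this work] -/
theorem sStarD_blockAnd_topCube_nonneg_of_coProduct (hS : IsUpperSet (S : Set (Pd n))) (htop : ∀ ξ ∈ S, ∀ a, ξ a ≠ 0)
    (hV : IsUpperSet (V : Set (Pd k))) (hA : ∀ ξ z, glue ξ z ∈ A ↔ (ξ ∈ S ∧ z ∈ V)) (dS : Pd n → ℤ) (dV : Pd k → ℤ)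
    (hTS : ∀ W : Finset (Pd n), IsUpperSet (W : Set (Pd n)) → (∑ ξ ∈ W, dS ξ) ≤ ∑ ξ ∈ W, lamU S ξ)
    (hmS : ∀ ξ : Pd n, dS ξ ≤ 2 * (2:ℤ) ^ n * ind S ξ)
    (hNS : ∀ X X' : Finset (Pd n), IsUpperSet (X : Set (Pd n)) → IsUpperSet (X' : Set (Pd n)) → (∑ q ∈ X, ∑ r ∈ X', thetaVal S q r) ≤ ∑ q ∈ X ∩ X', dS q)
    (hTV : ∀ W : Finset (Pd k), IsUpperSet (W : Set (Pd k)) → (∑ q ∈ W, dV q) ≤ ∑ q ∈ W, lamU V q)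
    (hdV : ∀ q, 0 ≤ dV q) (hmV : ∀ q : Pd k, dV q ≤ 2 * (2:ℤ) ^ k * ind V q)
    (hNV : ∀ X X' : Finset (Pd k), IsUpperSet (X : Set (Pd k)) → IsUpperSet (X' : Set (Pd k)) → (∑ q ∈ X, ∑ r ∈ X', thetaVal V q r) ≤ ∑ q ∈ X ∩ X', dV q)
    {B C : Finset (Pd (n + k))} (hB : IsUpperSet (B : Set (Pd (n + k)))) (hC : IsUpperSet (C : Set (Pd (n + k)))) :
    0 ≤ sStarD A B C :=
  sStarD_nonneg_of_diagCert A (fun x => 2 * (2:ℤ) ^ (n + k) * (ind S (freeOf x) * ind V (cellOf x))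
        - (2 * (2:ℤ) ^ n * ind S (freeOf x) - dS (freeOf x)) * (2 * (2:ℤ) ^ k * ind V (cellOf x) - dV (cellOf x)))
    (fun _ hW => diagCert_coProduct_T hA dS dV hTS hTV hmS hW)
    (fun _ _ hP hQ => diagCert_coProduct_N_topCube hS htop hV hA dS dV hNS hdV hmV hNV hP hQ) hB hC

end Summit.CriticalPhenomena.PercolationContinuityZ3.Theorems.SahiGridPattern
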